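import Summits.AtomisticToContinuum.Crystallization.Theorems.ExcessDecayLiouvilleDiscreteSobolev1D

/-!
# Route `ExcessDecayLiouville`: the tensor (2-D and 3-D) discrete Sobolev inequality

Step (c3) (`LatticeSobolev`) of the energy route for item `ExcessDecay` (stmt-AtomisticToContinuum-9334), abstract
part: for a function `G` on `ℕ³` with values in a seminormed group and a box `{0,…,n}³`, the value at any point of the
box is controlled by the box-`ℓ²` norms of `G` and of its mixed forward differences (at most one difference per
direction), with the scaling `n^{2|S|−3}` for a mixed difference of order `|S|`:

`‖G x y z‖² ≤ Σ_{S ⊆ {1,2,3}} (2/(n+1))^{3−|S|} (2n)^{|S|} Σ_box ‖D_S G‖²`   (`norm_sq_le_tensor_three`),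

obtained by applying the one-dimensional inequality `norm_sq_le_of_sum_sq` successively in the three directions
(`norm_sq_le_tensor_two` is the intermediate 2-D statement).  In lattice coordinates `(i,j,k) ↦ t_m + A(i u₁ + j u₂ + k w₃)`
of a sublattice this turns the `ℓ²` bounds on differences produced by the Caccioppoli iteration into pointwise bounds.
All `[folklore]`; helper lemmas, nothing here closes an item.
-/

noncomputable section

namespace Summit.AtomisticToContinuum.Crystallization.Theorems.ExcessDecayLiouville

open scoped BigOperators

section TensorSobolev

variable {F : Type*} [SeminormedAddCommGroup F]

/-- Distribution step used twice: from `X ≤ a Σ_i A_i + b Σ_i B_i` and termwise bounds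
`A_i ≤ a P_i + b Q_i`, `B_i ≤ a R_i + b S_i` (`a, b ≥ 0`) conclude
`X ≤ a² Σ P + a b Σ Q + b a Σ R + b² Σ S`. [folklore] -/
theorem le_of_two_level_bounds {ι : Type*} (s : Finset ι) {X a b : ℝ} (ha : 0 ≤ a) (hb : 0 ≤ b)
    {A B P Q R S : ι → ℝ} (hX : X ≤ a * ∑ i ∈ s, A i + b * ∑ i ∈ s, B i)
    (hA : ∀ i ∈ s, A i ≤ a * P i + b * Q i) (hB : ∀ i ∈ s, B i ≤ a * R i + b * S i) :
    X ≤ a * a * ∑ i ∈ s, P i + a * b * ∑ i ∈ s, Q i + b * a * ∑ i ∈ s, R i + b * b * ∑ i ∈ s, S i := by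
  have h1 : ∑ i ∈ s, A i ≤ a * ∑ i ∈ s, P i + b * ∑ i ∈ s, Q i := by
    rw [Finset.mul_sum, Finset.mul_sum, ← Finset.sum_add_distrib]
    exact Finset.sum_le_sum hA
  have h2 : ∑ i ∈ s, B i ≤ a * ∑ i ∈ s, R i + b * ∑ i ∈ s, S i := by
    rw [Finset.mul_sum, Finset.mul_sum, ← Finset.sum_add_distrib]
    exact Finset.sum_le_sum hB
  have h3 := mul_le_mul_of_nonneg_left h1 ha
  have h4 := mul_le_mul_of_nonneg_left h2 hb
  nlinarith [h3, h4, hX]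

/-- **2-D tensor discrete Sobolev inequality** on the box `{0..n}²`: for `x, y ≤ n`,
`‖G x y‖² ≤ (2/(n+1))² ΣΣ‖G‖² + (2/(n+1))(2n) ΣΣ‖D₂G‖² + (2n)(2/(n+1)) ΣΣ‖D₁G‖² + (2n)² ΣΣ‖D₂D₁G‖²`. [folklore] -/
theorem norm_sq_le_tensor_two (G : ℕ → ℕ → F) {n x y : ℕ} (hx : x ≤ n) (hy : y ≤ n) :
    ‖G x y‖ ^ 2 ≤
      (2 / (n + 1 : ℝ)) * (2 / (n + 1 : ℝ)) *
          ∑ i ∈ Finset.range (n + 1), ∑ j ∈ Finset.range (n + 1), ‖G i j‖ ^ 2 +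
      (2 / (n + 1 : ℝ)) * (2 * n) *
          ∑ i ∈ Finset.range (n + 1), ∑ j ∈ Finset.range n, ‖G i (j + 1) - G i j‖ ^ 2 +
      (2 * n) * (2 / (n + 1 : ℝ)) *
          ∑ i ∈ Finset.range n, ∑ j ∈ Finset.range (n + 1), ‖G (i + 1) j - G i j‖ ^ 2 +
      (2 * n) * (2 * n) *
          ∑ i ∈ Finset.range n, ∑ j ∈ Finset.range n,
            ‖(G (i + 1) (j + 1) - G i (j + 1)) - (G (i + 1) j - G i j)‖ ^ 2 := by
  have ha : (0 : ℝ) ≤ 2 / (n + 1) := by positivity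
  have hb : (0 : ℝ) ≤ 2 * n := by positivity
  -- direction 1 at height y
  have h1 := norm_sq_le_of_sum_sq (fun i => G i y) hx
  have h1' : ‖G x y‖ ^ 2 ≤ 2 / (n + 1 : ℝ) * ∑ i ∈ Finset.range (n + 1), ‖G i y‖ ^ 2 +
      2 * n * ∑ i ∈ Finset.range n, ‖G (i + 1) y - G i y‖ ^ 2 := by
    have : 2 * (∑ i ∈ Finset.range (n + 1), ‖G i y‖ ^ 2) / (n + 1 : ℝ) =
        2 / (n + 1 : ℝ) * ∑ i ∈ Finset.range (n + 1), ‖G i y‖ ^ 2 := by ring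
    rw [this] at h1
    exact h1
  -- direction 2 for each column
  have hA : ∀ i ∈ Finset.range (n + 1), ‖G i y‖ ^ 2 ≤
      2 / (n + 1 : ℝ) * ∑ j ∈ Finset.range (n + 1), ‖G i j‖ ^ 2 +
        2 * n * ∑ j ∈ Finset.range n, ‖G i (j + 1) - G i j‖ ^ 2 := by
    intro i _
    have h := norm_sq_le_of_sum_sq (fun j => G i j) hy
    have : 2 * (∑ j ∈ Finset.range (n + 1), ‖G i j‖ ^ 2) / (n + 1 : ℝ) =
        2 / (n + 1 : ℝ) * ∑ j ∈ Finset.range (n + 1), ‖G i j‖ ^ 2 := by ring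
    rw [this] at h
    exact h
  have hB : ∀ i ∈ Finset.range n, ‖G (i + 1) y - G i y‖ ^ 2 ≤
      2 / (n + 1 : ℝ) * ∑ j ∈ Finset.range (n + 1), ‖G (i + 1) j - G i j‖ ^ 2 +
        2 * n * ∑ j ∈ Finset.range n, ‖(G (i + 1) (j + 1) - G i (j + 1)) - (G (i + 1) j - G i j)‖ ^ 2 := by
    intro i _
    have h := norm_sq_le_of_sum_sq (fun j => G (i + 1) j - G i j) hy
    have : 2 * (∑ j ∈ Finset.range (n + 1), ‖G (i + 1) j - G i j‖ ^ 2) / (n + 1 : ℝ) =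
        2 / (n + 1 : ℝ) * ∑ j ∈ Finset.range (n + 1), ‖G (i + 1) j - G i j‖ ^ 2 := by ring
    rw [this] at h
    exact h
  -- the two index ranges differ (range (n+1) for A, range n for B): distribute separately
  have hsumA : ∑ i ∈ Finset.range (n + 1), ‖G i y‖ ^ 2 ≤
      2 / (n + 1 : ℝ) * ∑ i ∈ Finset.range (n + 1), ∑ j ∈ Finset.range (n + 1), ‖G i j‖ ^ 2 +
        2 * n * ∑ i ∈ Finset.range (n + 1), ∑ j ∈ Finset.range n, ‖G i (j + 1) - G i j‖ ^ 2 := by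
    rw [Finset.mul_sum, Finset.mul_sum, ← Finset.sum_add_distrib]
    exact Finset.sum_le_sum hA
  have hsumB : ∑ i ∈ Finset.range n, ‖G (i + 1) y - G i y‖ ^ 2 ≤
      2 / (n + 1 : ℝ) * ∑ i ∈ Finset.range n, ∑ j ∈ Finset.range (n + 1), ‖G (i + 1) j - G i j‖ ^ 2 +
        2 * n * ∑ i ∈ Finset.range n, ∑ j ∈ Finset.range n,
          ‖(G (i + 1) (j + 1) - G i (j + 1)) - (G (i + 1) j - G i j)‖ ^ 2 := by
    rw [Finset.mul_sum, Finset.mul_sum, ← Finset.sum_add_distrib]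
    exact Finset.sum_le_sum hB
  have h3 := mul_le_mul_of_nonneg_left hsumA ha
  have h4 := mul_le_mul_of_nonneg_left hsumB hb
  nlinarith [h1', h3, h4]

/-- **3-D tensor discrete Sobolev inequality** on the box `{0..n}³`: for `x, y, z ≤ n`, `‖G x y z‖²` is bounded by the
eight box sums of squared mixed forward differences `D_S G`, `S ⊆ {1,2,3}`, with coefficients
`(2/(n+1))^{3−|S|} (2n)^{|S|}` (differences taken in the order: direction 3 outermost; the box sums are written with the
third index outermost, `Σ_k Σ_i Σ_j`). [folklore] -/
theorem norm_sq_le_tensor_three (G : ℕ → ℕ → ℕ → F) {n x y z : ℕ} (hx : x ≤ n) (hy : y ≤ n) (hz : z ≤ n) :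
    ‖G x y z‖ ^ 2 ≤
      (2 / (n + 1 : ℝ)) *
        ((2 / (n + 1 : ℝ)) * (2 / (n + 1 : ℝ)) *
            ∑ k ∈ Finset.range (n + 1), ∑ i ∈ Finset.range (n + 1), ∑ j ∈ Finset.range (n + 1), ‖G i j k‖ ^ 2 +
        (2 / (n + 1 : ℝ)) * (2 * n) *
            ∑ k ∈ Finset.range (n + 1), ∑ i ∈ Finset.range (n + 1), ∑ j ∈ Finset.range n,
              ‖G i (j + 1) k - G i j k‖ ^ 2 +
        (2 * n) * (2 / (n + 1 : ℝ)) *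
            ∑ k ∈ Finset.range (n + 1), ∑ i ∈ Finset.range n, ∑ j ∈ Finset.range (n + 1),
              ‖G (i + 1) j k - G i j k‖ ^ 2 +
        (2 * n) * (2 * n) *
            ∑ k ∈ Finset.range (n + 1), ∑ i ∈ Finset.range n, ∑ j ∈ Finset.range n,
              ‖(G (i + 1) (j + 1) k - G i (j + 1) k) - (G (i + 1) j k - G i j k)‖ ^ 2) +
      (2 * n) *
        ((2 / (n + 1 : ℝ)) * (2 / (n + 1 : ℝ)) *
            ∑ k ∈ Finset.range n, ∑ i ∈ Finset.range (n + 1), ∑ j ∈ Finset.range (n + 1),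
              ‖G i j (k + 1) - G i j k‖ ^ 2 +
        (2 / (n + 1 : ℝ)) * (2 * n) *
            ∑ k ∈ Finset.range n, ∑ i ∈ Finset.range (n + 1), ∑ j ∈ Finset.range n,
              ‖(G i (j + 1) (k + 1) - G i (j + 1) k) - (G i j (k + 1) - G i j k)‖ ^ 2 +
        (2 * n) * (2 / (n + 1 : ℝ)) *
            ∑ k ∈ Finset.range n, ∑ i ∈ Finset.range n, ∑ j ∈ Finset.range (n + 1),
              ‖(G (i + 1) j (k + 1) - G (i + 1) j k) - (G i j (k + 1) - G i j k)‖ ^ 2 +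
        (2 * n) * (2 * n) *
            ∑ k ∈ Finset.range n, ∑ i ∈ Finset.range n, ∑ j ∈ Finset.range n,
              ‖((G (i + 1) (j + 1) (k + 1) - G (i + 1) (j + 1) k) - (G i (j + 1) (k + 1) - G i (j + 1) k)) -
                ((G (i + 1) j (k + 1) - G (i + 1) j k) - (G i j (k + 1) - G i j k))‖ ^ 2) := by
  have ha : (0 : ℝ) ≤ 2 / (n + 1) := by positivity
  have hb : (0 : ℝ) ≤ 2 * n := by positivity
  -- direction 3 at the point (x, y)
  have h1 := norm_sq_le_of_sum_sq (fun k => G x y k) hz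
  have h1' : ‖G x y z‖ ^ 2 ≤ 2 / (n + 1 : ℝ) * ∑ k ∈ Finset.range (n + 1), ‖G x y k‖ ^ 2 +
      2 * n * ∑ k ∈ Finset.range n, ‖G x y (k + 1) - G x y k‖ ^ 2 := by
    have : 2 * (∑ k ∈ Finset.range (n + 1), ‖G x y k‖ ^ 2) / (n + 1 : ℝ) =
        2 / (n + 1 : ℝ) * ∑ k ∈ Finset.range (n + 1), ‖G x y k‖ ^ 2 := by ring
    rw [this] at h1
    exact h1
  -- 2-D inequality in the (x, y) slab for each k, for G(·,·,k) and for D₃G(·,·,k)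
  have hA : ∀ k ∈ Finset.range (n + 1), ‖G x y k‖ ^ 2 ≤ _ := fun k _ => norm_sq_le_tensor_two (fun i j => G i j k) hx hy
  have hB : ∀ k ∈ Finset.range n, ‖G x y (k + 1) - G x y k‖ ^ 2 ≤ _ :=
    fun k _ => norm_sq_le_tensor_two (fun i j => G i j (k + 1) - G i j k) hx hy
  have hsumA := Finset.sum_le_sum hA
  have hsumB := Finset.sum_le_sum hB
  simp only [Finset.sum_add_distrib, ← Finset.mul_sum] at hsumA hsumB
  have h3 := mul_le_mul_of_nonneg_left hsumA ha
  have h4 := mul_le_mul_of_nonneg_left hsumB hb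
  linarith [h1', h3, h4]

end TensorSobolev

end Summit.AtomisticToContinuum.Crystallization.Theorems.ExcessDecayLiouville

end
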